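import Summits.ABC.IUTFork.Cor312EdgeAggregatePilotIVT
import Summits.ABC.IUTFork.Cor312VolumesRealFrames
import Summits.ABC.IUTFork.Cor312StatementPilotNouns
import HarnessLib

/-!
# [IUTchIII] Corollary 3.12 — readings of the edge, V quater: the intermediate-value hypothesis `hivt` of
# `Cor312EdgeAggregatePilotIVT` DISCHARGED at the assembled real-frames setting (proof-only companion; abc-iut-w5-d166)

Record-only file (D-0012) of the abc-iut cell; TAKES NO SIDE. abc-iut-w5-d204's `Cor312EdgeAggregatePilotIVT.lean`
(p413937) shows, in the author's nouns (`Thm311.PilotNouns` over `LatticeSituation`), that the aggregate INEQUALITY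
`Cor312At` already yields V-e's aggregate Reading 4 `QCongruentSubHullAgg` (Yamashita2024IUTSurvey Cor. 13.13 proof
p. 360 ll. 30–40, read with the print's global quantifier of [IUTchIII] Cor. 3.12 p. 173–174) PROVIDED that at ONE
component `(j₀, v_{ℚ,0})` the hull `^{n,∘}𝒰_{j₀,v_{ℚ,0}}` has "intermediate values down to `−∞`" — the hypothesis `hivt`,
stated inline there: every real `y ≤ μ^log(𝒰)` is the log-volume of an admissible sub-region of `𝒰`. That file leaves
`hivt` as a binder ("what an archimedean packet supplies — balls of every radius").

This file DISCHARGES `hivt` for the cell's REAL volumes: abc-iut-c312-6's `Cor312Vol.FrameVolumePieces` (field factors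
`K_i`, a surjective comparison `e`, a `FactorVolume` and a nonnegative weight per factor, box-admissibility `Adm`,
`logvol = Σ_i w_i·log vol_i`; [IUTchIII] Rmk. 3.1.1 (ii) p. 94, Prop. 3.9 (i) p. 115, Rmk. 3.9.5 p. 127) carried by the
line data (`Realizes`), assembled by abc-iut-c312-7's `Setting.ofFrames` (per-packet hull frames, hull-sets `λ·𝒪_L`),
and read in the author's nouns through c312-7's dictionary `Setting.toPilotNouns` (`uhol_eq`: `Uhol = thetaHull`, `rfl`):

* §1 `FactorVolume`: the inline "archimedean-type" hypothesis on ONE factor — every real number is the log-volume of a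
  closed ball of positive radius — HOLDS for c312-6's `complexRadial` ([AbsTopIII] Prop. 5.7 (ii): the radial volume,
  `μ^log(B(0,r)) = log r`; `complexRadial_logvol_closedBall`, `complexRadial_exists_logvol_closedBall_eq`) and is
  transported along `FactorVolume.precomp` (e.g. `K_v ≅ ℂ`); with monotonicity it yields radii BELOW any given one
  (`exists_le_logvol_closedBall_eq`). It fails for Haar volumes of nonarchimedean fields (discrete values), which is
  why the hypothesis is placed on one factor only.
* §2 `FrameVolumePieces.exists_adm_subset_preimage_hullSet` — on a hull-set `e⁻¹(λ·𝒪_L)`, shrinking the ball of a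
  factor `i₀` of positive weight with that property realises EVERY `y ≤ μ^log(e⁻¹(λ·𝒪_L)) = Σ_i w_i·μ̇^log_i(λ_i)` as the
  log-volume of an admissible sub-box.
* §3 `FrameVolumePieces.hullIVTAt_ofFrames` — hence, for `Setting.ofFrames … (V.toRealFrames θBox qC) …` over a line
  realizing `V`, at a packet `(j, v_ℚ)` where the hull is defined (`HullDefined`: then `^{n,∘}𝒰_{j,v_ℚ}` IS a hull-set,
  `comap_hull` + `hull_mem_of_hasHull` + `hul_iff`) and some factor is archimedean-type with positive weight, the
  hypothesis `hivt` of p413937 HOLDS.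
* §4 In the author's nouns: `qCongruentSubHullAgg_of_cor312At_ofFrames` — at that setting `Cor312At ⟹ QCongruentSubHullAgg`
  with NO `hivt` binder; `qCongruentSubHullAgg_of_statement_ofFrames` — the verbatim `Cor312.Setting.Statement` of the
  assembled real-frames setting implies V-e's aggregate Reading 4 as soon as one packet at a label `j ∈ 𝔽_l^⋇` has an
  archimedean-type factor of positive weight (`HullDefined` there follows from `ThetaFinite ⟸ Statement`).

So the (G1′)-level sentence of V-e / p413937 ("with the print's global quantifier, Reading 4 carries no content beyond
the inequality once one component has intermediate values") is kernel-checked AT THE REAL FRAMES, not only over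
abstract containers. Bookkeeping over LANDED decls only (c312-6 `FrameVolumePieces`/`FactorVolume.complexRadial`/
`Realizes`, c312-7 `Setting.ofFrames`/`HullFrame.comap_hull`/`toPilotNouns`/`cor312At_of_statement`, c312-1
`PilotNouns.Cor312At`, V-e `QCongruentSubHullAgg`, w5-d204 `qCongruentSubHullAgg_of_cor312At_of_hullIVTAt`); no new
definition, no new `Prop` fact; nothing here asserts that any reading is supplied or excluded by [IUTchIII]; typed ≠
proved; no side is taken on Cor. 3.12.
[cite: Yamashita2024IUTSurvey, Cor. 13.13 proof p. 360 ll. 30–40] [cite: MochizukiAbsTopIII2015, Prop. 5.7 (ii) p. 138]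
[claim: Mochizuki2012, status: disputed]
-/

noncomputable section

open Set Metric

namespace Summit.ABC.IUTFork.Cor312Vol

open Thm311 Cor312 Literature.IUT.LogVolume Literature.IUT.LogThetaLattice

variable {T : ThetaIndex}

/-! ## 1. Archimedean-type factor volumes: every real number is the log-volume of a closed ball -/

namespace FactorVolume

/-- The radial volume of a closed disc: `μ^log_ℂ(B(0,r)) = log r` for `r ≥ 0` ([AbsTopIII] Prop. 5.7 (ii):
`μ̇^log(x) = log ‖x‖`, here at `x = r ∈ ℂ`). [cite: MochizukiAbsTopIII2015, Prop. 5.7 (ii) p. 138] -/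
theorem complexRadial_logvol_closedBall {r : ℝ} (hr : 0 ≤ r) :
    complexRadial.logvol (closedBall 0 r) = Real.log r := by
  have h := complexRadial_mulLogvol (r : ℂ)
  rw [Complex.norm_of_nonneg hr] at h
  rw [← h]
  show complexRadial.logvol (closedBall 0 r) = complexRadial.logvol (closedBall 0 ‖(r : ℂ)‖)
  rw [Complex.norm_of_nonneg hr]

/-- **The archimedean factor volume takes EVERY real log-volume on closed discs**: `μ^log_ℂ(B(0, e^t)) = t`. This is
the "intermediate values down to `−∞`" property that nonarchimedean Haar volumes lack. [cite: MochizukiAbsTopIII2015, Prop. 5.7 (ii) p. 138] -/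
theorem complexRadial_exists_logvol_closedBall_eq (t : ℝ) :
    ∃ r : ℝ, 0 < r ∧ complexRadial.logvol (closedBall 0 r) = t :=
  ⟨Real.exp t, Real.exp_pos t, by rw [complexRadial_logvol_closedBall (Real.exp_pos t).le, Real.log_exp]⟩

/-- The log-volume of a closed ball is unchanged by `precomp` along a map preserving closed balls about `0`
(e.g. an isometric isomorphism `K_v ≅ ℂ` at a complex place). [folklore] -/
theorem precomp_logvol_closedBall {K K' : Type} [NormedField K] [NormedField K'] (μ : FactorVolume K')
    (f : K → K') (hf : ∀ r : ℝ, f '' closedBall 0 r = closedBall 0 r) (r : ℝ) :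
    (μ.precomp f hf).logvol (closedBall 0 r) = μ.logvol (closedBall 0 r) := by
  show Real.log (μ.vol (f '' closedBall 0 r)).toReal = Real.log (μ.vol (closedBall 0 r)).toReal
  rw [hf]

/-- The archimedean-type property is transported along `precomp`. [folklore] -/
theorem precomp_exists_logvol_closedBall_eq {K K' : Type} [NormedField K] [NormedField K'] (μ : FactorVolume K')
    (f : K → K') (hf : ∀ r : ℝ, f '' closedBall 0 r = closedBall 0 r)
    (h : ∀ t : ℝ, ∃ r : ℝ, 0 < r ∧ μ.logvol (closedBall 0 r) = t) (t : ℝ) :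
    ∃ r : ℝ, 0 < r ∧ (μ.precomp f hf).logvol (closedBall 0 r) = t := by
  obtain ⟨r, hr, hrt⟩ := h t
  exact ⟨r, hr, by rw [precomp_logvol_closedBall, hrt]⟩

/-- With monotonicity, an archimedean-type factor volume realises every `t ≤ μ^log(B(0,r₀))` (`r₀ > 0`) by a closed
ball of radius `0 < r ≤ r₀`. [folklore] -/
theorem exists_le_logvol_closedBall_eq {K : Type} [NormedField K] (μ : FactorVolume K)
    (h : ∀ t : ℝ, ∃ r : ℝ, 0 < r ∧ μ.logvol (closedBall 0 r) = t) {r₀ : ℝ} (hr₀ : 0 < r₀) {t : ℝ}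
    (ht : t ≤ μ.logvol (closedBall 0 r₀)) :
    ∃ r : ℝ, 0 < r ∧ r ≤ r₀ ∧ μ.logvol (closedBall 0 r) = t := by
  obtain ⟨r, hr, hrt⟩ := h t
  by_cases hle : r ≤ r₀
  · exact ⟨r, hr, hle, hrt⟩
  · refine ⟨r₀, hr₀, le_rfl, le_antisymm ?_ ht⟩
    rw [← hrt]
    exact μ.logvol_mono (μ.ball_ne_zero r₀ hr₀) (μ.ball_ne_top r)
      (closedBall_subset_closedBall (le_of_not_ge hle))

end FactorVolume

/-! ## 2. Intermediate values on hull-sets of a packet with an archimedean-type factor -/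

namespace FrameVolumePieces

variable {L : LogShells T} (V : FrameVolumePieces L) (j : T.Label) (vQ : T.VQ)

/-- The preimage of a box of closed balls with positive radii is box-admissible. [folklore] -/
theorem adm_preimage_pi_closedBall (ρ : V.J j vQ → ℝ) (hρ : ∀ i, 0 < ρ i) :
    V.Adm j vQ (V.e j vQ ⁻¹' Set.pi univ fun i => closedBall (0 : V.K j vQ i) (ρ i)) :=
  ⟨fun i => closedBall 0 (ρ i), by rw [Set.image_preimage_eq _ (V.e_surjective j vQ)],
    fun i => ⟨(V.vol j vQ i).ball_ne_zero _ (hρ i), (V.vol j vQ i).ball_ne_top _⟩⟩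

/-- The log-volume of the preimage of a box of closed balls with nonnegative radii is the weighted sum of the
factors' ball log-volumes. [folklore] -/
theorem logvol_preimage_pi_closedBall (ρ : V.J j vQ → ℝ) (hρ : ∀ i, 0 ≤ ρ i) :
    V.logvol j vQ (V.e j vQ ⁻¹' Set.pi univ fun i => closedBall (0 : V.K j vQ i) (ρ i)) =
      ∑ i, V.w j vQ i * (V.vol j vQ i).logvol (closedBall 0 (ρ i)) :=
  V.logvol_preimage_pi j vQ fun i => ⟨0, by simp [hρ i]⟩

/-- **Intermediate values on a hull-set.** On `e⁻¹(λ·𝒪_L)` (`λ_i ≠ 0`), if some factor `i₀` has positive weight and an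
archimedean-type volume (every real number is the log-volume of a closed ball), then EVERY
`y ≤ μ^log(e⁻¹(λ·𝒪_L)) = Σ_i w_i·μ̇^log_i(λ_i)` is the log-volume of an admissible sub-region: the box with the `i₀`-th
ball shrunk to the radius `r ≤ ‖λ_{i₀}‖` solving `w_{i₀}·μ^log_{i₀}(B(0,r)) = y − Σ_{i ≠ i₀} w_i·μ̇^log_i(λ_i)`. [folklore] -/
theorem exists_adm_subset_preimage_hullSet (c : ∀ i, V.K j vQ i) (hc : ∀ i, c i ≠ 0) (i₀ : V.J j vQ)
    (hw : 0 < V.w j vQ i₀)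
    (hvol : ∀ t : ℝ, ∃ r : ℝ, 0 < r ∧ (V.vol j vQ i₀).logvol (closedBall 0 r) = t)
    {y : ℝ} (hy : y ≤ V.logvol j vQ (V.e j vQ ⁻¹' hullSet (V.K j vQ) c)) :
    ∃ R : Set (L.Packet j vQ), V.Adm j vQ R ∧ R ⊆ V.e j vQ ⁻¹' hullSet (V.K j vQ) c ∧ V.logvol j vQ R = y := by
  classical
  -- the summands of the closed form `Σ_i w_i·μ̇^log_i(λ_i)` and the part away from `i₀`
  set f : V.J j vQ → ℝ := fun i => V.w j vQ i * (V.vol j vQ i).logvol (closedBall 0 ‖c i‖) with hf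
  set S₀ : ℝ := ∑ i ∈ (Finset.univ.erase i₀), f i with hS₀
  have hclosed : V.logvol j vQ (V.e j vQ ⁻¹' hullSet (V.K j vQ) c) = S₀ + f i₀ := by
    rw [V.logvol_preimage_hullSet j vQ c, hS₀, Finset.sum_erase_add _ _ (Finset.mem_univ i₀)]
    exact Finset.sum_congr rfl fun i _ => rfl
  -- the target log-volume of the `i₀`-th ball
  set t : ℝ := (y - S₀) / V.w j vQ i₀ with ht
  have htle : t ≤ (V.vol j vQ i₀).logvol (closedBall 0 ‖c i₀‖) := by
    rw [ht, div_le_iff₀ hw]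
    have : y ≤ S₀ + V.w j vQ i₀ * (V.vol j vQ i₀).logvol (closedBall 0 ‖c i₀‖) := by rw [hclosed] at hy; exact hy
    linarith
  obtain ⟨r, hr, hrle, hrt⟩ :=
    FactorVolume.exists_le_logvol_closedBall_eq (V.vol j vQ i₀) hvol (norm_pos_iff.mpr (hc i₀)) htle
  -- the shrunk box
  set ρ : V.J j vQ → ℝ := Function.update (fun i => ‖c i‖) i₀ r with hρ
  have hρ₀ : ρ i₀ = r := by rw [hρ, Function.update_self]
  have hρne : ∀ i, i ≠ i₀ → ρ i = ‖c i‖ := fun i hi => by rw [hρ, Function.update_of_ne hi]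
  have hρpos : ∀ i, 0 < ρ i := by
    intro i
    by_cases hi : i = i₀
    · rw [hi, hρ₀]; exact hr
    · rw [hρne i hi]; exact norm_pos_iff.mpr (hc i)
  have hρle : ∀ i, ρ i ≤ ‖c i‖ := by
    intro i
    by_cases hi : i = i₀
    · rw [hi, hρ₀]; exact hrle
    · rw [hρne i hi]
  refine ⟨V.e j vQ ⁻¹' Set.pi univ fun i => closedBall (0 : V.K j vQ i) (ρ i),
    V.adm_preimage_pi_closedBall j vQ ρ hρpos, ?_, ?_⟩
  · -- containment in `λ·𝒪_L = Π_i B(0, ‖λ_i‖)`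
    exact Set.preimage_mono (Set.pi_mono fun i _ => closedBall_subset_closedBall (hρle i))
  · -- the log-volume
    rw [V.logvol_preimage_pi_closedBall j vQ ρ fun i => (hρpos i).le,
      ← Finset.sum_erase_add _ _ (Finset.mem_univ i₀), hρ₀, hrt]
    have herase : ∑ i ∈ Finset.univ.erase i₀, V.w j vQ i * (V.vol j vQ i).logvol (closedBall 0 (ρ i)) = S₀ := by
      rw [hS₀]
      exact Finset.sum_congr rfl fun i hi => by rw [hρne i (Finset.ne_of_mem_erase hi)]
    rw [herase, ht]
    field_simp
    ring

end FrameVolumePieces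

/-! ## 3. The hypothesis `hivt` at the assembled real-frames setting -/

namespace FrameVolumePieces

section Assembled

variable {S : Situation T} (V : FrameVolumePieces S.L) {n : ℤ}
  {HT : Type} {LogLink : HT → HT → Type} {IsFull : ∀ {s t : HT}, LogLink s t → Prop}
  (lat : LGPGaussianLogThetaLattice LogLink IsFull)
  {Frd : Type} {IsoF : Frd → Frd → Type} {Ob : Frd → Type} {realify : Frd → Frd} {Strip : Type}
  {IsoS : Strip → Strip → Type} {M : ∀ v : T.V, v ∈ T.Vbad → Type} [∀ v h, Monoid (M v h)]
  (sig : GlobalLGPFrobenioidSignature T.lstar T.V (· ∈ T.Vbad) Frd IsoF Ob realify Strip IsoS M)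
  (split : SplittingMonoids M) {ObΔ : Type} {N : ∀ v : T.V, v ∈ T.Vbad → Type} [∀ v h, Monoid (N v h)]
  (qData : QPilotData ObΔ N)
  (thetaBox : ℤ → Ob sig.Clgp → ∀ j vQ, Set (∀ i, V.K j vQ i))
  (qCentre : ObΔ → ∀ j vQ, ∀ i, V.K j vQ i)
  (hq : ∀ j vQ i, qCentre (qPilotObject qData) j vQ i ≠ 0)
  (hadm : ∀ j vQ (H : Set (∀ i, V.K j vQ i)), IsHullSet (V.K j vQ) H → (S.D n).Adm j vQ (V.e j vQ ⁻¹' H))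
  (hfin : ∀ j : T.Label, (Function.support fun vQ => (S.D n).logvol j vQ
    (V.e j vQ ⁻¹' hullSet (V.K j vQ) (qCentre (qPilotObject qData) j vQ))).Finite)

/-- Under `HullDefined`, the hull `^{n,∘}𝒰_{j,v_ℚ}` of the real-frames setting IS the preimage of a hull-set `λ·𝒪_L`
(`λ_i ≠ 0`): the frame is pulled back along `e` (`comap_hull`), the hull of the image is a hull-set of the real frame
(`hull_mem_of_hasHull`), and the real frame's hull-sets are S2's (`hul_iff`). [folklore] -/
theorem thetaHull_ofFrames_eq_preimage_hullSet (j : T.Label) (vQ : T.VQ)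
    (hdef : (Setting.ofFrames n lat sig split qData (V.toRealFrames thetaBox qCentre) hq hadm hfin).HullDefined j vQ) :
    ∃ c : ∀ i, V.K j vQ i, (∀ i, c i ≠ 0) ∧
      (Setting.ofFrames n lat sig split qData (V.toRealFrames thetaBox qCentre) hq hadm hfin).thetaHull j vQ =
        V.e j vQ ⁻¹' hullSet (V.K j vQ) c := by
  have hb : (V.frameK j vQ).IsBounded (V.e j vQ '' ⋃₀ (Setting.ofFrames n lat sig split qData
      (V.toRealFrames thetaBox qCentre) hq hadm hfin).possibleImages j vQ) := hdef.1
  have hh : (V.frameK j vQ).HasHull (V.e j vQ '' ⋃₀ (Setting.ofFrames n lat sig split qData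
      (V.toRealFrames thetaBox qCentre) hq hadm hfin).possibleImages j vQ) := hdef.2
  obtain ⟨c, hc, hceq⟩ := (V.hul_iff j vQ _).1 ((V.frameK j vQ).hull_mem_of_hasHull hb hh)
  refine ⟨c, hc, ?_⟩
  show ((V.frameK j vQ).comap (V.e j vQ)).hull _ = _
  rw [HullFrame.comap_hull _ _ hb, hceq]

/-- **The hypothesis `hivt` of `Cor312EdgeAggregatePilotIVT` HOLDS at the assembled real-frames setting**: over a line
realizing `V`, at a packet `(j, v_ℚ)` where the hull is defined and some field factor `i₀` has positive weight and an
archimedean-type volume, every real `y ≤ μ^log(^{n,∘}𝒰_{j,v_ℚ})` is the log-volume of an admissible sub-region of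
`^{n,∘}𝒰_{j,v_ℚ}`. [folklore] -/
theorem hullIVTAt_ofFrames (hV : V.Realizes (S.D n)) (j : T.Label) (vQ : T.VQ)
    (hdef : (Setting.ofFrames n lat sig split qData (V.toRealFrames thetaBox qCentre) hq hadm hfin).HullDefined j vQ)
    (i₀ : V.J j vQ) (hw : 0 < V.w j vQ i₀)
    (hvol : ∀ t : ℝ, ∃ r : ℝ, 0 < r ∧ (V.vol j vQ i₀).logvol (closedBall 0 r) = t)
    {y : ℝ} (hy : y ≤ (S.D n).logvol j vQ
      ((Setting.ofFrames n lat sig split qData (V.toRealFrames thetaBox qCentre) hq hadm hfin).thetaHull j vQ)) :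
    ∃ R : Set (S.L.Packet j vQ), (S.D n).Adm j vQ R ∧
      R ⊆ (Setting.ofFrames n lat sig split qData (V.toRealFrames thetaBox qCentre) hq hadm hfin).thetaHull j vQ ∧
      (S.D n).logvol j vQ R = y := by
  obtain ⟨c, hc, hceq⟩ := V.thetaHull_ofFrames_eq_preimage_hullSet lat sig split qData thetaBox qCentre hq hadm hfin
    j vQ hdef
  rw [hceq, hV.logvol_eq] at hy
  obtain ⟨R, hR, hRsub, hRvol⟩ := V.exists_adm_subset_preimage_hullSet j vQ c hc i₀ hw hvol hy
  exact ⟨R, (hV.adm_iff j vQ R).2 hR, by rw [hceq]; exact hRsub, by rw [hV.logvol_eq]; exact hRvol⟩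

end Assembled

/-! ## 4. In the author's nouns: `Cor312At ⟹` aggregate Reading 4 at the real frames, no `hivt` binder -/

section PilotNouns

variable {S : LatticeSituation T} (V : FrameVolumePieces S.L) {n : ℤ}
  {HT : Type} {LogLink : HT → HT → Type} {IsFull : ∀ {s t : HT}, LogLink s t → Prop}
  (lat : LGPGaussianLogThetaLattice LogLink IsFull)
  {Frd : Type} {IsoF : Frd → Frd → Type} {Ob : Frd → Type} {realify : Frd → Frd} {Strip : Type}
  {IsoS : Strip → Strip → Type} {M : ∀ v : T.V, v ∈ T.Vbad → Type} [∀ v h, Monoid (M v h)]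
  (sig : GlobalLGPFrobenioidSignature T.lstar T.V (· ∈ T.Vbad) Frd IsoF Ob realify Strip IsoS M)
  (split : SplittingMonoids M) {ObΔ : Type} {N : ∀ v : T.V, v ∈ T.Vbad → Type} [∀ v h, Monoid (N v h)]
  (qData : QPilotData ObΔ N)
  (thetaBox : ℤ → Ob sig.Clgp → ∀ j vQ, Set (∀ i, V.K j vQ i))
  (qCentre : ObΔ → ∀ j vQ, ∀ i, V.K j vQ i)
  (hq : ∀ j vQ i, qCentre (qPilotObject qData) j vQ i ≠ 0)
  (hadm : ∀ j vQ (H : Set (∀ i, V.K j vQ i)), IsHullSet (V.K j vQ) H → (S.D n).Adm j vQ (V.e j vQ ⁻¹' H))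
  (hfin : ∀ j : T.Label, (Function.support fun vQ => (S.D n).logvol j vQ
    (V.e j vQ ⁻¹' hullSet (V.K j vQ) (qCentre (qPilotObject qData) j vQ))).Finite)

/-- **`Cor312At ⟹ QCongruentSubHullAgg` at the real frames, with no `hivt` binder.** For the nouns
`Setting.toPilotNouns` of the assembled real-frames setting (c312-7's dictionary: `Uhol = thetaHull` by `rfl`) over a
line realizing `V`: if ONE component `(j₀, v_{ℚ,0})`, `j₀ ∈ 𝔽_l^⋇`, has its hull defined and an archimedean-type field
factor of positive weight, then the author's aggregate inequality `Cor312At n m` yields V-e's aggregate Reading 4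
`QCongruentSubHullAgg n m` (w5-d204's `qCongruentSubHullAgg_of_cor312At_of_hullIVTAt`, its `hivt` supplied by
`hullIVTAt_ofFrames`). [cite: Yamashita2024IUTSurvey, Cor. 13.13 proof p. 360 ll. 30–40] -/
theorem qCongruentSubHullAgg_of_cor312At_ofFrames (hV : V.Realizes (S.D n)) (m : ℤ) (j₀ : T.LabelStar)
    (vQ₀ : T.VQ)
    (hdef : (Setting.ofFrames n lat sig split qData (V.toRealFrames thetaBox qCentre) hq hadm hfin).HullDefined
      j₀.1 vQ₀)
    (i₀ : V.J j₀.1 vQ₀) (hw : 0 < V.w j₀.1 vQ₀ i₀)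
    (hvol : ∀ t : ℝ, ∃ r : ℝ, 0 < r ∧ (V.vol j₀.1 vQ₀ i₀).logvol (closedBall 0 r) = t)
    (h : (Setting.ofFrames n lat sig split qData (V.toRealFrames thetaBox qCentre) hq hadm
      hfin).toPilotNouns.Cor312At n m) :
    (Setting.ofFrames n lat sig split qData (V.toRealFrames thetaBox qCentre) hq hadm
      hfin).toPilotNouns.QCongruentSubHullAgg n m :=
  PilotNouns.qCongruentSubHullAgg_of_cor312At_of_hullIVTAt _ n m j₀ vQ₀
    (fun _ hy => V.hullIVTAt_ofFrames lat sig split qData thetaBox qCentre hq hadm hfin hV j₀.1 vQ₀ hdef i₀ hw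
      hvol hy) h

/-- **The verbatim `Statement` ⟹ the aggregate Reading 4, at the real frames.** If the assembled real-frames setting
(over a line realizing `V`) satisfies c312-7's verbatim `Cor312.Setting.Statement` ("`−|log(Θ)| ∈ ℝ` and
`−|log(Θ)| ≥ −|log(q)|`") and ONE packet at a label `j₀ ∈ 𝔽_l^⋇` has an archimedean-type field factor of positive weight,
then V-e's aggregate Reading 4 holds for its nouns (at every `m`): `Statement ⟹ ThetaFinite ⟹ HullDefined` everywhere on
`𝔽_l^⋇` (c312-7 `thetaFinite_of_statement`, `hullDefined_of_thetaFinite`), `Statement ⟹ Cor312At` (c312-7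
`cor312At_of_statement`), then `qCongruentSubHullAgg_of_cor312At_ofFrames`. [cite: Yamashita2024IUTSurvey, Cor. 13.13 proof p. 360 ll. 30–40] -/
theorem qCongruentSubHullAgg_of_statement_ofFrames (hV : V.Realizes (S.D n)) (m : ℤ) (j₀ : T.LabelStar)
    (vQ₀ : T.VQ) (i₀ : V.J j₀.1 vQ₀) (hw : 0 < V.w j₀.1 vQ₀ i₀)
    (hvol : ∀ t : ℝ, ∃ r : ℝ, 0 < r ∧ (V.vol j₀.1 vQ₀ i₀).logvol (closedBall 0 r) = t)
    (hs : (Setting.ofFrames n lat sig split qData (V.toRealFrames thetaBox qCentre) hq hadm hfin).Statement) :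
    (Setting.ofFrames n lat sig split qData (V.toRealFrames thetaBox qCentre) hq hadm
      hfin).toPilotNouns.QCongruentSubHullAgg n m := by
  have hfinΘ := (Setting.ofFrames n lat sig split qData (V.toRealFrames thetaBox qCentre) hq hadm
    hfin).thetaFinite_of_statement hs
  have hdef : (Setting.ofFrames n lat sig split qData (V.toRealFrames thetaBox qCentre) hq hadm hfin).HullDefined
      j₀.1 vQ₀ := by
    have := (Setting.ofFrames n lat sig split qData (V.toRealFrames thetaBox qCentre) hq hadm
      hfin).hullDefined_of_thetaFinite hfinΘ ((succEquiv T).symm j₀) vQ₀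
    rwa [labelSucc_symm] at this
  exact V.qCongruentSubHullAgg_of_cor312At_ofFrames lat sig split qData thetaBox qCentre hq hadm hfin hV m j₀ vQ₀
    hdef i₀ hw hvol ((Setting.ofFrames n lat sig split qData (V.toRealFrames thetaBox qCentre) hq hadm
      hfin).cor312At_of_statement m hs)

end PilotNouns

end FrameVolumePieces

end Summit.ABC.IUTFork.Cor312Vol

end
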